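import Literature.AlgebraicGeometry.Frobenioids.EquivalencePreStepsFSMType
import Literature.AlgebraicGeometry.Frobenioids.BaseCategoryTheoreticityProofs
import Literature.AlgebraicGeometry.Frobenioids.IsotropicFrobenioid
import Mathlib.CategoryTheory.ObjectProperty.Equivalence
import HarnessLib

/-!
# Frobenioids I, §3: Theorem 3.4 (ii) for Frobenioids of quasi-isotropic type over bases of FSM-type

Mochizuki, *The geometry of Frobenioids I: the general theory*, Kyushu J. Math. **62** (2008),
Thm. 3.4 (ii), kurims p. 62; proof p. 63: "By assertion (i) [cf. also Proposition 1.9, (v)] … we reduce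
immediately to the case where `C₁`, `C₂` are of isotropic type" [cite: MochizukiFrdI2008, Thm. 3.4 (ii) p.63].

PROOF-ONLY (seat abc-iut-L1-t13; the cell's repair programme, OURS): the reduction of the printed proof,
carried out for the repaired isotropic core `FrdI.thm34ii_isotropic_of_isOfFSMType`. For Frobenioids
`C₁`, `C₂` of QUASI-ISOTROPIC type over bases of FSM-type and an equivalence `Ψ`: `Ψ` restricts to an
equivalence `Ψ^istr : C₁^istr ≌ C₂^istr` of the Frobenioids of isotropic objects (Thm. 3.4 (i); Prop. 1.9
(v), seat abc-iut-L1-t1's `isFrobenioid_istr`), and pre-steps / group-like objects of `C_i` are read off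
through isotropic hulls (Def. 1.3 (vii)(a), Prop. 1.7 (v)): `FrdI.thm34ii_of_isOfFSMType` — `Ψ` preserves
pre-steps, co-angular pre-steps and group-like objects. This is Thm. 3.4 (ii) with "`D_i` of FSMFF-type"
strengthened to "`D_i` of FSM-type" (connected objects of Galois categories, Rem. 3.1.3). No statement of
the paper is restated or strengthened; the printed statement stays typed as `FrdI.Thm34ii` (open).
-/

set_option backward.isDefEq.respectTransparency false

namespace Literature.AlgebraicGeometry.Frobenioids

open CategoryTheory Opposite

universe w v v' u u'

/-! ### Mid-adjointness is transported by equivalences -/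

section Mid

variable {C₁ : Type u} [Category.{v} C₁] {C₂ : Type u'} [Category.{v'} C₂]

/-- An equivalence carries an arrow mid-adjoint to `S₁` to an arrow mid-adjoint to any class `S₂` whose
`e.inverse`-images lie in `S₁`, provided `S₁` is stable under composition with isomorphisms on both sides.
[cite: MochizukiFrdI2008, §0 p.17] -/
theorem IsMidAdjoint.map_equivalence (e : C₁ ≌ C₂) {S₁ : MorphismProperty C₁} {S₂ : MorphismProperty C₂}
    (hS : ∀ ⦃X Y : C₂⦄ (β : X ⟶ Y), S₂ β → S₁ (e.inverse.map β))
    {A B : C₁} {φ : A ⟶ B} (h : IsMidAdjoint S₁ φ) : IsMidAdjoint S₂ (e.functor.map φ) := by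
  intro X' Y' γ' β' α' hfac hβ'
  have key : e.unit.app A ≫ e.inverse.map γ' ≫ e.inverse.map β' ≫ e.inverse.map α' ≫ e.unitInv.app B = φ := by
    rw [← e.inverse.map_comp_assoc, ← e.inverse.map_comp_assoc, Category.assoc, hfac, e.inv_fun_map]
    simp
  have hfac₁ : (e.unit.app A ≫ e.inverse.map γ') ≫ e.inverse.map β' ≫
      (e.inverse.map α' ≫ e.unitInv.app B) = φ := by
    simpa only [Category.assoc] using key
  haveI := h _ _ _ hfac₁ (hS β' hβ')
  exact isIso_of_fully_faithful e.inverse β'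

end Mid

namespace FrdI

section Two

variable {D₁ : Type u} [Category.{v} D₁] {Φ₁ : D₁ᵒᵖ ⥤ CommMonCat.{w}} {C₁ : Type u'}
  [Category.{v'} C₁] {D₂ : Type u} [Category.{v} D₂] {Φ₂ : D₂ᵒᵖ ⥤ CommMonCat.{w}} {C₂ : Type u'}
  [Category.{v'} C₂] {F₁ : C₁ ⥤ ElemFrobenioid Φ₁} {F₂ : C₂ ⥤ ElemFrobenioid Φ₂}

/-- **Thm. 3.4 (ii) for quasi-isotropic Frobenioids over bases of FSM-type**, pre-steps: `Ψ` preserves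
pre-steps (reduction to `C^istr` through isotropic hulls + `isPreStep_map_of_isOfFSMType`).
[cite: MochizukiFrdI2008, Thm. 3.4 (ii) p.63] -/
theorem isPreStep_map_of_quasiIsotropic_of_isOfFSMType (hF₁ : PreFrobenioid.IsFrobenioid F₁)
    (hF₂ : PreFrobenioid.IsFrobenioid F₂)
    (hq₁ : (PreFrobenioidData.ofFunctor Φ₁ F₁).IsOfQuasiIsotropicType)
    (hq₂ : (PreFrobenioidData.ofFunctor Φ₂ F₂).IsOfQuasiIsotropicType) (hD₂ : IsOfFSMType D₂)
    (Ψ : C₁ ≌ C₂) {A B : C₁} {φ : A ⟶ B} (hφ : PreFrobenioid.IsPreStep F₁ φ) :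
    PreFrobenioid.IsPreStep F₂ (Ψ.functor.map φ) := by
  have hP₁ := hF₁.isPreFrobenioid
  have hP₂ := hF₂.isPreFrobenioid
  -- `Ψ^istr : C₁^istr ≌ C₂^istr`
  haveI : (PreFrobenioid.isotropicObjects F₂).IsClosedUnderIsomorphisms :=
    ⟨fun e hX => PreFrobenioid.IsIsotropic.of_iso hP₂ e.symm hX⟩
  have hinv : (PreFrobenioid.isotropicObjects F₂).inverseImage Ψ.functor = PreFrobenioid.isotropicObjects F₁ := by
    funext X
    apply propext
    constructor
    · intro hX
      exact PreFrobenioid.IsIsotropic.of_iso hP₁ (Ψ.unitIso.app X) (isIsotropic_map hq₂ hq₁ Ψ.symm hX)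
    · intro hX
      exact isIsotropic_map hq₁ hq₂ Ψ hX
  let Ψi : PreFrobenioid.Istr F₁ ≌ PreFrobenioid.Istr F₂ := Ψ.congrFullSubcategory hinv
  -- isotropic hulls of the endpoints and the induced pre-step between them
  obtain ⟨A', hA, hhA⟩ := hF₁.vii_a A
  obtain ⟨B', hB, hhB⟩ := hF₁.vii_a B
  obtain ⟨-, hpA, hA'i, hunivA⟩ := id hhA
  obtain ⟨-, hpB, hB'i, -⟩ := id hhB
  obtain ⟨φ', hφ', -⟩ := hunivA (φ ≫ hB) hB'i
  -- hφ' : hA ≫ φ' = φ ≫ hB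
  have hφ'p : PreFrobenioid.IsPreStep F₁ φ' :=
    (PreFrobenioid.isPreStep_factors F₁ hP₁.isTotallyEpimorphic_base
      (show PreFrobenioid.IsPreStep F₁ (hA ≫ φ') by rw [hφ']; exact PreFrobenioid.IsPreStep.comp F₁ hφ hpB)).1
  -- apply the isotropic core to `Ψ^istr`
  let a : PreFrobenioid.Istr F₁ := ⟨A', hA'i⟩
  let b : PreFrobenioid.Istr F₁ := ⟨B', hB'i⟩
  let f : a ⟶ b := ObjectProperty.homMk φ'
  have hf : PreFrobenioid.IsPreStep (PreFrobenioid.istrFunctor F₁) f := hφ'p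
  have hcore := isPreStep_map_of_isOfFSMType (PreFrobenioid.isFrobenioid_istr hF₁)
    (PreFrobenioid.isFrobenioid_istr hF₂) (fun X => PreFrobenioid.isIsotropic_istr X)
    (fun X => PreFrobenioid.isIsotropic_istr X) hD₂ Ψi hf
  have hΨφ' : PreFrobenioid.IsPreStep F₂ (Ψ.functor.map φ') := hcore
  -- transfer along the hulls: `Ψφ ≫ Ψh_B = Ψh_A ≫ Ψφ'`
  obtain ⟨-, hΨhAp, -, -⟩ := isIsotropicHull_map hF₁ hF₂ hq₁ hq₂ Ψ hhA
  have hcomp : PreFrobenioid.IsPreStep F₂ (Ψ.functor.map φ ≫ Ψ.functor.map hB) := by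
    rw [← Functor.map_comp, ← hφ', Functor.map_comp]
    exact PreFrobenioid.IsPreStep.comp F₂ hΨhAp hΨφ'
  exact (PreFrobenioid.isPreStep_factors F₂ hP₂.isTotallyEpimorphic_base hcomp).2

/-- **Thm. 3.4 (ii) for quasi-isotropic Frobenioids over bases of FSM-type**, co-angular pre-steps
(Prop. 1.7 (iv): a pre-step is co-angular iff mid-adjoint to the isometric pre-steps, which `Ψ⁻¹`
preserves by Thm. 3.4 (i)). [cite: MochizukiFrdI2008, Thm. 3.4 (ii) p.63] -/
theorem isCoAngularPreStep_map_of_quasiIsotropic_of_isOfFSMType (hF₁ : PreFrobenioid.IsFrobenioid F₁)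
    (hF₂ : PreFrobenioid.IsFrobenioid F₂)
    (hq₁ : (PreFrobenioidData.ofFunctor Φ₁ F₁).IsOfQuasiIsotropicType)
    (hq₂ : (PreFrobenioidData.ofFunctor Φ₂ F₂).IsOfQuasiIsotropicType) (hD₂ : IsOfFSMType D₂)
    (Ψ : C₁ ≌ C₂) {A B : C₁} {φ : A ⟶ B} (hφ : PreFrobenioid.IsCoAngularPreStep F₁ φ) :
    PreFrobenioid.IsCoAngularPreStep F₂ (Ψ.functor.map φ) := by
  have hp := isPreStep_map_of_quasiIsotropic_of_isOfFSMType hF₁ hF₂ hq₁ hq₂ hD₂ Ψ hφ.2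
  refine ⟨?_, hp⟩
  rw [PreFrobenioid.isCoAngular_iff_isMidAdjoint_of_isPreStep F₂ hF₂ _ hp]
  have h1 := (PreFrobenioid.isCoAngular_iff_isMidAdjoint_of_isPreStep F₁ hF₁ _ hφ.2).1 hφ.1
  refine h1.map_equivalence Ψ (fun X Y β hβ => ?_)
  obtain ⟨hi, hpre⟩ := isIsometry_isPreStep_map hF₂ hF₁ hq₂ hq₁ Ψ.symm hβ.1 hβ.2
  exact ⟨hi, hpre⟩

/-- **Thm. 3.4 (ii) for quasi-isotropic Frobenioids over bases of FSM-type**, group-like objects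
(through the isotropic hull, a base-isomorphism, and `isGroupLikeObj_map_of_isOfFSMType` on `C^istr`).
[cite: MochizukiFrdI2008, Thm. 3.4 (ii) p.63] -/
theorem isGroupLikeObj_map_of_quasiIsotropic_of_isOfFSMType (hF₁ : PreFrobenioid.IsFrobenioid F₁)
    (hF₂ : PreFrobenioid.IsFrobenioid F₂)
    (hq₁ : (PreFrobenioidData.ofFunctor Φ₁ F₁).IsOfQuasiIsotropicType)
    (hq₂ : (PreFrobenioidData.ofFunctor Φ₂ F₂).IsOfQuasiIsotropicType) (hD₁ : IsOfFSMType D₁)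
    (Ψ : C₁ ≌ C₂) {A : C₁} (hA : PreFrobenioid.IsGroupLikeObj F₁ A) :
    PreFrobenioid.IsGroupLikeObj F₂ (Ψ.functor.obj A) := by
  have hP₁ := hF₁.isPreFrobenioid
  have hP₂ := hF₂.isPreFrobenioid
  haveI : (PreFrobenioid.isotropicObjects F₂).IsClosedUnderIsomorphisms :=
    ⟨fun e hX => PreFrobenioid.IsIsotropic.of_iso hP₂ e.symm hX⟩
  have hinv : (PreFrobenioid.isotropicObjects F₂).inverseImage Ψ.functor = PreFrobenioid.isotropicObjects F₁ := by
    funext X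
    apply propext
    constructor
    · intro hX
      exact PreFrobenioid.IsIsotropic.of_iso hP₁ (Ψ.unitIso.app X) (isIsotropic_map hq₂ hq₁ Ψ.symm hX)
    · intro hX
      exact isIsotropic_map hq₁ hq₂ Ψ hX
  let Ψi : PreFrobenioid.Istr F₁ ≌ PreFrobenioid.Istr F₂ := Ψ.congrFullSubcategory hinv
  obtain ⟨A', h, hh⟩ := hF₁.vii_a A
  obtain ⟨-, hp, hA'i, -⟩ := id hh
  haveI : IsIso (PreFrobenioid.Base F₁ h) := hp.2
  -- `A'` is group-like
  have hA' : PreFrobenioid.IsGroupLikeObj F₁ A' := fun x => by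
    have := hA (pull Φ₁ (PreFrobenioid.Base F₁ h) x)
    exact (hP₁.isMonoidOn.isCharInjective (PreFrobenioid.Base F₁ h)).1 (this.trans (map_one _).symm)
  -- through `Ψ^istr`
  have hcore : PreFrobenioid.IsGroupLikeObj F₂ (Ψ.functor.obj A') :=
    isGroupLikeObj_map_of_isOfFSMType (PreFrobenioid.isFrobenioid_istr hF₁)
      (PreFrobenioid.isFrobenioid_istr hF₂) (fun X => PreFrobenioid.isIsotropic_istr X)
      (fun X => PreFrobenioid.isIsotropic_istr X) hD₁ Ψi (A := ⟨A', hA'i⟩) hA'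
  -- back along the base-isomorphism `Ψ h`
  obtain ⟨-, hΨhp, -, -⟩ := isIsotropicHull_map hF₁ hF₂ hq₁ hq₂ Ψ hh
  haveI : IsIso (PreFrobenioid.Base F₂ (Ψ.functor.map h)) := hΨhp.2
  intro x
  have hx : x = pull Φ₂ (PreFrobenioid.Base F₂ (Ψ.functor.map h))
      (pull Φ₂ (inv (PreFrobenioid.Base F₂ (Ψ.functor.map h))) x) := by
    rw [← pull_comp, IsIso.hom_inv_id, pull_id]
  rw [hx, hcore (pull Φ₂ (inv (PreFrobenioid.Base F₂ (Ψ.functor.map h))) x), map_one]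

/-- **Thm. 3.4 (ii) for Frobenioids of quasi-isotropic type over bases of FSM-type** (the cell's
repaired variant; the printed statement has FSMFF-type bases): `Ψ` preserves pre-steps, co-angular
pre-steps and group-like objects. [cite: MochizukiFrdI2008, Thm. 3.4 (ii) p.62] -/
theorem thm34ii_of_isOfFSMType (hF₁ : PreFrobenioid.IsFrobenioid F₁) (hF₂ : PreFrobenioid.IsFrobenioid F₂)
    (hq₁ : (PreFrobenioidData.ofFunctor Φ₁ F₁).IsOfQuasiIsotropicType)
    (hq₂ : (PreFrobenioidData.ofFunctor Φ₂ F₂).IsOfQuasiIsotropicType) (hD₁ : IsOfFSMType D₁)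
    (hD₂ : IsOfFSMType D₂) (Ψ : C₁ ≌ C₂) :
    PreFrobenioidData.PreservesMor Ψ.functor (PreFrobenioidData.ofFunctor Φ₁ F₁).IsPreStep
        (PreFrobenioidData.ofFunctor Φ₂ F₂).IsPreStep ∧
      PreFrobenioidData.PreservesMor Ψ.functor (PreFrobenioidData.ofFunctor Φ₁ F₁).IsCoAngularPreStep
        (PreFrobenioidData.ofFunctor Φ₂ F₂).IsCoAngularPreStep ∧
      PreFrobenioidData.PreservesObj Ψ.functor (PreFrobenioidData.ofFunctor Φ₁ F₁).IsGroupLikeObj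
        (PreFrobenioidData.ofFunctor Φ₂ F₂).IsGroupLikeObj := by
  refine ⟨fun A B φ hφ => isPreStep_map_of_quasiIsotropic_of_isOfFSMType hF₁ hF₂ hq₁ hq₂ hD₂ Ψ hφ,
    fun A B φ hφ => ?_, fun A hA => isGroupLikeObj_map_of_quasiIsotropic_of_isOfFSMType hF₁ hF₂ hq₁ hq₂ hD₁ Ψ hA⟩
  have h := isCoAngularPreStep_map_of_quasiIsotropic_of_isOfFSMType hF₁ hF₂ hq₁ hq₂ hD₂ Ψ
    ⟨(PreFrobenioidData.ofFunctor_isCoAngular F₁ φ).1 hφ.1, hφ.2⟩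
  exact ⟨(PreFrobenioidData.ofFunctor_isCoAngular F₂ _).2 h.1, h.2⟩

end Two

end FrdI

end Literature.AlgebraicGeometry.Frobenioids
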